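import Summits.CriticalPhenomena.PercolationContinuityZ3.Theorems.PercNearOneGluingNoHeavyQuantOneArmSteepness
import Literature.Probability.Percolation.StaticRenormalizationSprinkling
import HarnessLib

/-!
# QUANT lane (p4 gen 20): the Bernoulli first-passage time `T_n` BELOW `p_c` grows LINEARLY —
# `P_p(T_n ≤ k) ≤ p^{−(r+1)k} e^{−cn}` (sprinkling + sharpness) and `E_p[T_n] ≥ c′n − C` for `0 < p < p_c`

builds on p205010 (kernel theorem, internal audit signed; external expert review pending) — NOT used in this file.

Seat `prim-quant-p4` (METHOD = differential inequalities for `θ` near `p_c`), helper file `--supports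
stmt-CriticalPhenomena-4575`; pure proofs, no definitions (objects: `…QuantPassageTimeDefs`: `passTimeLE d n k = {T_n ≤ k}`,
`meanPassTime d n p = E_p[T_n]`; `T_n` = least number of closed lattice edges on a lattice path from `0` to `∂ⁱⁿΛ_n` inside
`Λ_n`, the Bernoulli first-passage time).  With the two companions this completes the phase diagram of `E_p[T_n]` for
Bernoulli bond percolation on `ℤ^d`, `d ≥ 2`:

* `0 < p < p_c`: **`c′n − C ≤ E_p[T_n] ≤ n`** (this file; Kesten's "positive time constant iff `F(0) < p_c`", lower half, in the
  point-to-sphere form, by Grimmett's sprinkling inequality (2.49) (tree `sprinkling_le`) and the Menshikov / Aizenman–Barsky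
  / Duminil-Copin–Tassion exponential decay of `θ_n` below `p_c` (tree `DCT16.perc_sharpness_holds`); the constants are those of
  the sharpness theorem, not explicit);
* `p = p_c`: `E_{p_c}[T_n] → ∞` (`…QuantPassageTimeCritical`, p205010; no rate);
* `p_c < p < 1`: `E_p[T_n] ≤ E_p[ρ] ≤ log(2/(p−p_c))/(2(p−p_c))` bounded (`…QuantPassageTimeSupercritical`).

* `pow_mul_real_passTimeLE_le` — `p^{(r+1)k}·P_p(T_n ≤ k) ≤ P_{p̂}(A_n)`, `p̂ = sprinkleParam p 1 r` (sprinkling);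
* **`exists_real_passTimeLE_le_exp`** — for `0 < p < p_c` (`d ≥ 2`): `∃ a, c > 0, ∀ n k, P_p(T_n ≤ k) ≤ exp(a k − c n)`;
* **`exists_linear_le_meanPassTime`** — `∃ c′ > 0, C, ∀ n, c′ n − C ≤ E_p[T_n]`.

## References
* H. Kesten, *Aspects of first passage percolation* (1986), Thm. 6.1 (`μ > 0 ⟺ F(0) < p_c`) [KestenAspects1986].
* G. Grimmett, *Percolation* (1999), §2.6 Thm. (2.45)/(2.49) (sprinkling), Thms (5.4)/(6.1) (exponential decay) [GrimmettPercolation1999].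
* H. Duminil-Copin, V. Tassion, Enseign. Math. 62 (2016), Thm. 1.1(1) [DuminilCopinTassionEM2016].
* A. Auffinger, M. Damron, J. Hanson (2017), §3.7.1 [AuffingerDamronHanson2017].
-/

noncomputable section

namespace Summit.CriticalPhenomena.PercolationContinuityZ3.Theorems

namespace PassTime

open MeasureTheory Set Filter Literature.Probability.Percolation Literature.Probability.LatticeModels
open scoped Classical Topology

variable {d : ℕ}

/-- **Sprinkling for the passage time**: `p^{(r+1)k} · P_p(T_n ≤ k) ≤ P_{p̂}(0 ↔ ∂Λ_n)` with `p̂ = sprinkleParam p 1 r ≤ p + p^{r+1}`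
(every configuration of `{T_n ≤ k}` is moved into the arm event by opening at most `k` lattice edges of `Λ_n`). -/
theorem pow_mul_real_passTimeLE_le (p : unitInterval) (r n k : ℕ) :
    (p : ℝ) ^ ((r + 1) * k) * (bondPercolation (zdGraph d) p).real (passTimeLE d n k) ≤
      (bondPercolation (zdGraph d) (sprinkleParam p 1 r)).real (DKT20.armEvent (d := d) 0 n) :=
  sprinkling_le p r k (DKT20.coe_edgesIn_subset (d := d) n) (determinedBy_passTimeLE d n k)
    (DKT20.isUpperSet_armEvent 0 n) (DKT20.measurableSet_armEvent 0 n) fun _ hω => hω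

/-- **Exponential bound below `p_c`**: for `d ≥ 2` and `0 < p < p_c` there are `a` and `c > 0` with
`P_p(T_n ≤ k) ≤ exp(a·k − c·n)` for all `n, k` (`a = (r+1) log(1/p)` from sprinkling to a density `p″ ∈ (p, p_c)`, `c` the
exponential decay rate of `θ_n(p″)`). -/
theorem exists_real_passTimeLE_le_exp (hd : 2 ≤ d) (p : unitInterval) (hp0 : 0 < (p : ℝ))
    (hpc : (p : ℝ) < criticalProb (zdGraph d) (0 : Site d)) :
    ∃ a c : ℝ, 0 < c ∧ ∀ n k : ℕ, (bondPercolation (zdGraph d) p).real (passTimeLE d n k) ≤ Real.exp (a * k - c * n) := by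
  have hpc1 : criticalProb (zdGraph d) (0 : Site d) ≤ 1 := (criticalProb_mem_Icc _ _).2
  have hp1 : (p : ℝ) < 1 := hpc.trans_le hpc1
  -- an intermediate density `p″ = (p + p_c)/2`
  set q : ℝ := ((p : ℝ) + criticalProb (zdGraph d) (0 : Site d)) / 2 with hq
  have hq0 : 0 ≤ q := by rw [hq]; linarith [(criticalProb_mem_Icc (zdGraph d) (0 : Site d)).1]
  have hq1 : q ≤ 1 := by rw [hq]; linarith
  set p'' : unitInterval := ⟨q, hq0, hq1⟩ with hp''
  have hpq : (p : ℝ) < p'' := by show (p : ℝ) < q; rw [hq]; linarith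
  have hqc : (p'' : ℝ) < criticalProb (zdGraph d) 0 := by show q < _; rw [hq]; linarith
  -- sprinkle from `p` to below `p″`
  obtain ⟨r, hr⟩ := exists_sprinkleParam_lt p hp1 1 (ε := (p'' : ℝ) - p) (by linarith)
  have hle : sprinkleParam p 1 r ≤ p'' := by
    show (sprinkleParam p 1 r : ℝ) ≤ p''; linarith
  -- exponential decay at `p″`
  obtain ⟨c, hc, hdecay⟩ := DCT16.perc_sharpness_holds hd p'' hqc
  refine ⟨(r + 1) * Real.log (1 / p), c, hc, fun n k => ?_⟩
  have hpk : 0 < (p : ℝ) ^ ((r + 1) * k) := pow_pos hp0 _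
  have h1 := pow_mul_real_passTimeLE_le (d := d) p r n k
  have h2 : (bondPercolation (zdGraph d) (sprinkleParam p 1 r)).real (DKT20.armEvent (d := d) 0 n) ≤
      Real.exp (-c * n) := by
    calc _ ≤ (bondPercolation (zdGraph d) p'').real (DKT20.armEvent (d := d) 0 n) :=
          DCT16.real_mono_of_isUpperSet (zdGraph d) (DKT20.isUpperSet_armEvent 0 n) (DKT20.measurableSet_armEvent 0 n) hle
      _ = (bondPercolation (zdGraph d) p'').real (siteToBoundary d n) :=
          DCT16.real_congr_of_forall_subset_edgeSet (zdGraph d) p'' fun ω hω => armEvent_zero_iff_siteToBoundary hω n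
      _ ≤ Real.exp (-c * n) := hdecay n
  -- divide by `p^{(r+1)k} = exp(−a k)`
  have hexp : Real.exp (((r : ℝ) + 1) * Real.log (1 / p) * k - c * n) =
      (1 / (p : ℝ)) ^ ((r + 1) * k) * Real.exp (-c * n) := by
    rw [Real.exp_sub, show ((r : ℝ) + 1) * Real.log (1 / p) * k = (((r + 1) * k : ℕ) : ℝ) * Real.log (1 / p) by
      push_cast; ring, Real.exp_nat_mul, Real.exp_log (by positivity), div_eq_mul_inv, ← Real.exp_neg, neg_mul]
  have h12 := h1.trans h2
  rw [hexp, one_div_pow, one_div, inv_mul_eq_div, le_div_iff₀ hpk]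
  linarith

/-- **Linear growth of the passage time below `p_c`** (the lower half of Kesten's "positive time constant iff `F(0) < p_c`",
point-to-sphere form, Bernoulli weights): for `d ≥ 2` and `0 < p < p_c` there are `c′ > 0` and `C` with
`c′·n − C ≤ E_p[T_n]` for every `n` (and `E_p[T_n] ≤ n` always). -/
theorem exists_linear_le_meanPassTime (hd : 2 ≤ d) (p : unitInterval) (hp0 : 0 < (p : ℝ))
    (hpc : (p : ℝ) < criticalProb (zdGraph d) (0 : Site d)) :
    ∃ c' C : ℝ, 0 < c' ∧ ∀ n : ℕ, c' * n - C ≤ meanPassTime d n p := by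
  have hd1 : 1 ≤ d := le_trans (by norm_num) hd
  obtain ⟨a, c, hc, hbound⟩ := exists_real_passTimeLE_le_exp hd p hp0 hpc
  -- `a ≥ 0` may be assumed (increase it): with `a⁺ = max a 1 > 0`
  set A : ℝ := max a 1 with hA
  have hA0 : 0 < A := lt_of_lt_of_le one_pos (le_max_right _ _)
  have hbound' : ∀ n k : ℕ, (bondPercolation (zdGraph d) p).real (passTimeLE d n k) ≤ Real.exp (A * k - c * n) :=
    fun n k => (hbound n k).trans (Real.exp_le_exp.2 (by
      have : a * k ≤ A * k := mul_le_mul_of_nonneg_right (le_max_left _ _) (Nat.cast_nonneg _)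
      linarith))
  refine ⟨c / (2 * A), Real.log 2 / (2 * A) + 1, div_pos hc (by positivity), fun n => ?_⟩
  -- `K = ⌊(cn − log 2)/A⌋₊`: for `k < K`, `P(T_n ≤ k) ≤ 1/2`
  set K : ℕ := ⌊(c * n - Real.log 2) / A⌋₊ with hK
  have hhalf : ∀ k : ℕ, k < K → (bondPercolation (zdGraph d) p).real (passTimeLE d n k) ≤ 1 / 2 := by
    intro k hk
    have hkK : (k : ℝ) ≤ (c * n - Real.log 2) / A := by
      have hK0 : 0 < K := lt_of_le_of_lt (Nat.zero_le k) hk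
      have hx0 : 0 ≤ (c * n - Real.log 2) / A := by
        by_contra hneg
        rw [hK, Nat.floor_of_nonpos (le_of_lt (not_le.1 hneg))] at hK0
        exact lt_irrefl 0 hK0
      have h1 : (k : ℝ) ≤ K := by exact_mod_cast hk.le
      exact h1.trans (by rw [hK]; exact Nat.floor_le hx0)
    have hAk : A * k - c * n ≤ -Real.log 2 := by
      have := mul_le_mul_of_nonneg_left hkK hA0.le
      rw [mul_div_cancel₀ _ hA0.ne'] at this
      linarith
    calc (bondPercolation (zdGraph d) p).real (passTimeLE d n k) ≤ Real.exp (A * k - c * n) := hbound' n k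
      _ ≤ Real.exp (-Real.log 2) := Real.exp_le_exp.2 hAk
      _ = 1 / 2 := by rw [Real.exp_neg, Real.exp_log two_pos, one_div]
  have hsum : (K : ℝ) / 2 ≤ ∑ k ∈ Finset.range K, (1 - (bondPercolation (zdGraph d) p).real (passTimeLE d n k)) := by
    calc (K : ℝ) / 2 = ∑ _k ∈ Finset.range K, (1 / 2 : ℝ) := by simp [Finset.sum_const]; ring
      _ ≤ _ := Finset.sum_le_sum fun k hk => by linarith [hhalf k (Finset.mem_range.1 hk)]
  have hKge : (c * n - Real.log 2) / A - 1 ≤ K := by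
    rw [hK]; exact (Nat.sub_one_lt_floor _).le
  calc c / (2 * A) * n - (Real.log 2 / (2 * A) + 1) ≤ ((c * n - Real.log 2) / A - 1) / 2 := by
        rw [show c / (2 * A) * n - (Real.log 2 / (2 * A) + 1) = ((c * n - Real.log 2) / A - 2) / 2 by field_simp; ring]
        linarith
    _ ≤ (K : ℝ) / 2 := by linarith
    _ ≤ _ := hsum
    _ ≤ meanPassTime d n p := sum_le_meanPassTime hd1 p n K

end PassTime

end Summit.CriticalPhenomena.PercolationContinuityZ3.Theorems

end
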